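import Mathlib
import HarnessLib
import Summits.CriticalPhenomena.CardyFormulaZ2.Theorems.CardyMagicRigidityMagicFormulaTHexCells
import Summits.CriticalPhenomena.CardyFormulaZ2.Theorems.CardyMagicRigidityMagicFormulaTStubCellBridge
import Summits.CriticalPhenomena.CardyFormulaZ2.Theorems.CardyMagicRigidityNestingRigidityShellPotential

/-!
# Radial kernels against cell densities (line `Sketch`, stub `stub_riemannLog`, 1)

Crux `Summit.CriticalPhenomena.CardyFormulaZ2.Theses.CardyMagicRigidity.MagicFormulaT`
(stmt-CriticalPhenomena-4836), line `Sketch` (card `kac-window-vertex-operators`), stub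
`stub_riemannLog` of the registered skeleton `Cruxes/MagicFormulaT/Lines/Sketch.lean` (Riemann
sums for the logarithmic energy); this helper file is registered on the crux as the sub-goal
`riemannLog_energyCellDecomposition` (its last theorem).  Tree vocabulary only (no definition;
the open Voronoi hexagon `H_x = {z | |hform i (z − triMeshPoint 1 x)| < 1 ∀ i}` of the unit
lattice is a local notation, as in `…MagicFormulaTHexCells`).

For a radial kernel `κ ‖·‖` integrable on discs (`κ = log`: the energy; `κ = 80/r`: its Coulomb
majorant) and a measurable density `g` with `|g| ≤ B`, `g = 0` off `B̄(0, ρ)`: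

* `‖·‖⁻¹` is integrable on the discs of `ℂ` with `∫_{B(0,r)} ‖v‖⁻¹ dv = 2πr` (Mathlib's radial
  change of variables `integral_fun_norm_addHaar`; `log ‖·‖` is `integrableOn_log_norm_ball` of
  `…NestingRigidityShellPotential`); `|log t| ≤ t + t⁻¹`;
* `w' ↦ κ‖w − w'‖ g(w')` is integrable, `∫ |κ‖w − w'‖| |g(w')| dw' ≤ B ∫_{B(0,‖w‖+ρ+1)} |κ‖v‖| dv`,
  the parametric set integrals `w ↦ ∫_A κ‖w − w'‖ g(w') dw'` are measurable (Fubini) and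
  `w ↦ g(w) ∫_A κ‖w − w'‖ g(w') dw'` is integrable;
* **cell decomposition of the energy** (`energy_eq_sum_sum`): if `g` vanishes a.e. off the
  cells of a finite set of sites `S` (disjoint measurable cells, `integral_eq_sum_setIntegral`
  of `…MagicFormulaTStubCellBridge` applied twice), then
  `∫∫ κ‖w − w'‖ g(w) g(w') dw' dw = Σ_{x ∈ S} Σ_{y ∈ S} ∫_{H_x} g(w) ∫_{H_y} κ‖w − w'‖ g(w') dw' dw`;
* the registered sub-goal: this decomposition for `κ = log` and the dilated density
  `f_δ = δ² f(δ ·)` of an admissible `f` on the charge sites `triBall ⌈2(R/δ + 1)⌉₊`.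

Folklore measure theory; no named facts are used.
-/

noncomputable section

namespace Summit.CriticalPhenomena.CardyFormulaZ2.Cruxes.MagicFormulaT.LineSketch

open MeasureTheory Filter Finset Set Metric
open scoped Real Topology BigOperators
open Literature.Probability.RandomPlanarGeometry Literature.Probability.Percolation
  Literature.Probability.LatticeModels
open Summit.CriticalPhenomena.CardyFormulaZ2.Cruxes.NestingRigidity.RingCloudTomography
  (integrableOn_log_norm_ball)

/-- The open Voronoi hexagon of the site `x` of the unit lattice (local notation, not a definition:
the stub is stated with this set written inline). -/
local notation3 (prettyPrint := false) "𝓗[" x "]" =>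
  {z : ℂ | ∀ i : Fin 3, |hform i (z - triMeshPoint 1 x)| < 1}

/-! ## Radial integrals in `ℂ` -/

/-- `‖·‖⁻¹` is integrable on every disc of `ℂ` (polar coordinates: the radial density is `1`). -/
theorem integrableOn_norm_inv_ball (r : ℝ) : IntegrableOn (fun v : ℂ ↦ ‖v‖⁻¹) (ball 0 r) := by
  rw [integrableOn_fun_norm_addHaar volume (f := fun y : ℝ ↦ y⁻¹), Complex.finrank_real_complex]
  refine (integrableOn_const (C := (1 : ℝ))
    (measure_Ioo_lt_top (a := (0 : ℝ)) (b := r)).ne).congr_fun (fun y hy ↦ ?_) measurableSet_Ioo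
  have hy0 : (y : ℝ) ≠ 0 := hy.1.ne'
  simp [hy0]

/-- The area of a disc about the origin. -/
theorem volume_real_ball_zero {r : ℝ} (hr : 0 ≤ r) : volume.real (ball (0 : ℂ) r) = π * r ^ 2 := by
  rw [measureReal_def, Complex.volume_ball, ENNReal.toReal_mul, ENNReal.toReal_pow,
    ENNReal.toReal_ofReal hr, ENNReal.coe_toReal, NNReal.coe_real_pi]
  ring

/-- **`∫_{B(0,r)} ‖v‖⁻¹ dv = 2πr`** (radial change of variables `integral_fun_norm_addHaar`). -/
theorem setIntegral_norm_inv_ball {r : ℝ} (hr : 0 ≤ r) :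
    ∫ v in ball (0 : ℂ) r, ‖v‖⁻¹ = 2 * π * r := by
  have h := integral_fun_norm_addHaar (volume : Measure ℂ)
    (fun y : ℝ ↦ (Iio r).indicator (fun y : ℝ ↦ y⁻¹) y)
  have hL : (fun x : ℂ ↦ (Iio r).indicator (fun y : ℝ ↦ y⁻¹) ‖x‖) =
      (ball (0 : ℂ) r).indicator (fun x ↦ ‖x‖⁻¹) := by
    funext x
    by_cases hx : x ∈ ball (0 : ℂ) r
    · have hx' : ‖x‖ ∈ Iio r := by simpa using hx
      rw [indicator_of_mem hx, indicator_of_mem hx']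
    · have hx' : ‖x‖ ∉ Iio r := by simpa using hx
      rw [indicator_of_notMem hx, indicator_of_notMem hx']
  rw [hL, integral_indicator measurableSet_ball, Complex.finrank_real_complex,
    volume_real_ball_zero zero_le_one] at h
  have hI : ∫ y in Ioi (0 : ℝ), y ^ (2 - 1) • (Iio r).indicator (fun y : ℝ ↦ y⁻¹) y = r := by
    have he : EqOn (fun y : ℝ ↦ y ^ (2 - 1) • (Iio r).indicator (fun y : ℝ ↦ y⁻¹) y)
        ((Iio r).indicator fun _ ↦ (1 : ℝ)) (Ioi 0) := by
      intro y hy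
      have hy0 : (y : ℝ) ≠ 0 := (mem_Ioi.1 hy).ne'
      by_cases hyr : y ∈ Iio r
      · simp [indicator_of_mem hyr, hy0]
      · simp [indicator_of_notMem hyr]
    rw [setIntegral_congr_fun measurableSet_Ioi he, setIntegral_indicator measurableSet_Iio,
      setIntegral_const, Ioi_inter_Iio, Real.volume_real_Ioo, sub_zero, max_eq_left hr,
      smul_eq_mul, mul_one]
  rw [h, hI, smul_eq_mul, nsmul_eq_mul]
  simp only [Nat.cast_ofNat, one_pow, mul_one]
  ring

/-- `|log t| ≤ t + t⁻¹` for `t ≥ 0` (`log s ≤ s − 1` at `s = t, t⁻¹`; junk conventions at `0`). -/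
theorem abs_log_le_add_inv {t : ℝ} (h0 : 0 ≤ t) : |Real.log t| ≤ t + t⁻¹ := by
  rcases h0.eq_or_lt with ht | ht
  · subst ht; simp
  · rw [abs_le]
    constructor
    · have := Real.log_le_sub_one_of_pos (inv_pos.2 ht)
      rw [Real.log_inv] at this
      linarith
    · have := Real.log_le_sub_one_of_pos ht
      have : 0 < t⁻¹ := inv_pos.2 ht
      linarith

/-! ## Bounded densities of bounded support -/

section Density

variable {g : ℂ → ℝ} {B ρ : ℝ}

/-- A measurable bounded density vanishing off `B̄(0, ρ)` is integrable. -/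
theorem integrable_of_bdd_of_supp (hg : Measurable g) (hB : ∀ z, |g z| ≤ B)
    (hρ : ∀ z, ρ < ‖z‖ → g z = 0) : Integrable g := by
  -- adapted from `integrable_dilate` (…MagicFormulaTStubCellBridge)
  refine IntegrableOn.integrable_of_forall_notMem_eq_zero (s := closedBall (0 : ℂ) ρ) ?_
    fun z hz ↦ hρ z (by simpa [not_le] using hz)
  refine Measure.integrableOn_of_bounded (M := B) measure_closedBall_lt_top.ne
    hg.aestronglyMeasurable (ae_of_all _ fun z ↦ ?_)
  rw [Real.norm_eq_abs]
  exact hB z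

/-- The `L¹` norm of a bounded density vanishing off `B̄(0, ρ)`, `ρ ≥ 0`, is at most `B π ρ²`. -/
theorem integral_abs_le_of_bdd_of_supp (hB : ∀ z, |g z| ≤ B) (hρ : ∀ z, ρ < ‖z‖ → g z = 0)
    (hρ0 : 0 ≤ ρ) : ∫ z, |g z| ≤ B * (π * ρ ^ 2) := by
  have hzero : ∀ z ∉ closedBall (0 : ℂ) ρ, |g z| = 0 := fun z hz ↦ by
    rw [hρ z (by simpa [not_le] using hz), abs_zero]
  rw [← setIntegral_eq_integral_of_forall_compl_eq_zero hzero]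
  have h1 := norm_setIntegral_le_of_norm_le_const
    (measure_closedBall_lt_top : volume (closedBall (0 : ℂ) ρ) < ⊤)
    (f := fun z ↦ |g z|) (fun z _ ↦ by rw [Real.norm_eq_abs, abs_abs]; exact hB z)
  rw [Real.norm_eq_abs] at h1
  refine (le_abs_self _).trans (h1.trans (le_of_eq ?_))
  rw [measureReal_def, Complex.volume_closedBall, ENNReal.toReal_mul, ENNReal.toReal_pow,
    ENNReal.toReal_ofReal hρ0, ENNReal.coe_toReal, NNReal.coe_real_pi]
  ring

end Density

/-! ## Radial kernels against bounded densities of bounded support -/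

section Kernel

variable {κ : ℝ → ℝ} {g : ℂ → ℝ} {B ρ : ℝ}

/-- Translation: `w' ↦ κ ‖w − w'‖` is integrable on `B(w, r)` if `κ ‖·‖` is on `B(0, r)`. -/
theorem integrableOn_kernel_sub_ball (hκ : ∀ r, IntegrableOn (fun v : ℂ ↦ κ ‖v‖) (ball 0 r))
    (w : ℂ) (r : ℝ) : IntegrableOn (fun w' : ℂ ↦ κ ‖w - w'‖) (ball w r) := by
  -- adapted from Cruxes/MagicFormulaT/Disproof.lean (`integrableOn_log_norm_sub_ball`)
  have h1 : MeasurePreserving (fun v : ℂ ↦ w + v) volume volume :=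
    measurePreserving_add_left volume w
  have h2 : MeasurableEmbedding (fun v : ℂ ↦ w + v) :=
    (MeasurableEquiv.addLeft w).measurableEmbedding
  have hpre : (fun v : ℂ ↦ w + v) ⁻¹' ball w r = ball 0 r := by
    ext v; simp [dist_eq_norm]
  have key := h1.integrableOn_comp_preimage h2 (f := fun w' : ℂ ↦ κ ‖w - w'‖) (s := ball w r)
  rw [hpre] at key
  refine key.1 ?_
  have : ((fun w' : ℂ ↦ κ ‖w - w'‖) ∘ fun v : ℂ ↦ w + v) = fun v ↦ κ ‖v‖ := by
    ext v; simp
  rw [this]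
  exact hκ r

/-- Translation of the set integral of a radial kernel over a disc. -/
theorem setIntegral_kernel_sub_ball (κ : ℝ → ℝ) (w : ℂ) (r : ℝ) :
    ∫ w' in ball w r, κ ‖w - w'‖ = ∫ v in ball (0 : ℂ) r, κ ‖v‖ := by
  -- adapted from Cruxes/MagicFormulaT/Disproof.lean (`setIntegral_abs_log_norm_sub_ball`)
  have h1 : MeasurePreserving (fun v : ℂ ↦ w + v) volume volume :=
    measurePreserving_add_left volume w
  have h2 : MeasurableEmbedding (fun v : ℂ ↦ w + v) :=
    (MeasurableEquiv.addLeft w).measurableEmbedding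
  have hpre : (fun v : ℂ ↦ w + v) ⁻¹' ball w r = ball 0 r := by
    ext v; simp [dist_eq_norm]
  have key := h1.setIntegral_preimage_emb h2 (fun w' : ℂ ↦ κ ‖w - w'‖) (ball w r)
  rw [hpre] at key
  rw [← key]
  simp

/-- Off the disc `B(w, ‖w‖ + ρ + 1)` the norm exceeds `ρ`. -/
theorem lt_norm_of_notMem_ball {w w' : ℂ} (hw' : w' ∉ ball w (‖w‖ + ρ + 1)) : ρ < ‖w'‖ := by
  by_contra hle
  apply hw'
  rw [mem_ball, dist_eq_norm]
  calc ‖w' - w‖ ≤ ‖w'‖ + ‖w‖ := norm_sub_le _ _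
    _ < ‖w‖ + ρ + 1 := by linarith [not_lt.1 hle]

/-- **The kernel against the density is integrable**: `w' ↦ κ ‖w − w'‖ g(w')`. -/
theorem integrable_kernel_mul (hκ : ∀ r, IntegrableOn (fun v : ℂ ↦ κ ‖v‖) (ball 0 r))
    (hg : Measurable g) (hB : ∀ z, |g z| ≤ B) (hρ : ∀ z, ρ < ‖z‖ → g z = 0) (w : ℂ) :
    Integrable (fun w' : ℂ ↦ κ ‖w - w'‖ * g w') := by
  have h := (integrableOn_kernel_sub_ball hκ w (‖w‖ + ρ + 1)).mul_bdd (c := B)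
    hg.aestronglyMeasurable (ae_of_all _ fun z ↦ by rw [Real.norm_eq_abs]; exact hB z)
  refine IntegrableOn.integrable_of_forall_notMem_eq_zero h fun w' hw' ↦ ?_
  rw [hρ _ (lt_norm_of_notMem_ball hw'), mul_zero]

/-- **Uniform bound**: `∫ |κ ‖w − w'‖| |g(w')| dw' ≤ B ∫_{B(0, ‖w‖ + ρ + 1)} |κ ‖v‖| dv`. -/
theorem integral_abs_kernel_mul_le (hκ : ∀ r, IntegrableOn (fun v : ℂ ↦ κ ‖v‖) (ball 0 r))
    (hB : ∀ z, |g z| ≤ B) (hρ : ∀ z, ρ < ‖z‖ → g z = 0) (w : ℂ) :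
    ∫ w', |κ ‖w - w'‖| * |g w'| ≤ B * ∫ v in ball (0 : ℂ) (‖w‖ + ρ + 1), |κ ‖v‖| := by
  set r := ‖w‖ + ρ + 1 with hr
  have hzero : ∀ w' ∉ ball w r, |κ ‖w - w'‖| * |g w'| = 0 := fun w' hw' ↦ by
    rw [hρ _ (lt_norm_of_notMem_ball hw'), abs_zero, mul_zero]
  rw [← setIntegral_eq_integral_of_forall_compl_eq_zero hzero]
  have hκ' : ∀ r, IntegrableOn (fun v : ℂ ↦ |κ ‖v‖|) (ball 0 r) := fun r ↦ (hκ r).abs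
  calc ∫ w' in ball w r, |κ ‖w - w'‖| * |g w'|
      ≤ ∫ w' in ball w r, |κ ‖w - w'‖| * B := by
        refine integral_mono_of_nonneg (ae_of_all _ fun w' ↦ by positivity)
          ((integrableOn_kernel_sub_ball (κ := fun t ↦ |κ t|) hκ' w r).mul_const B)
          (ae_of_all _ fun w' ↦ ?_)
        exact mul_le_mul_of_nonneg_left (hB w') (abs_nonneg _)
    _ = B * ∫ v in ball (0 : ℂ) r, |κ ‖v‖| := by
        rw [integral_mul_const, mul_comm, setIntegral_kernel_sub_ball (fun t ↦ |κ t|) w r]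

/-- **Fubini measurability** of the parametric set integral `w ↦ ∫_{A} κ ‖w − w'‖ g(w') dw'`. -/
theorem aestronglyMeasurable_setIntegral_kernel (hκm : Measurable κ) (hg : Measurable g)
    (A : Set ℂ) :
    AEStronglyMeasurable (fun w : ℂ ↦ ∫ w' in A, κ ‖w - w'‖ * g w') volume := by
  -- adapted from Cruxes/MagicFormulaT/Disproof.lean (`stronglyMeasurable_J`)
  refine (StronglyMeasurable.integral_prod_right (ν := volume.restrict A)
    (f := fun w w' : ℂ ↦ κ ‖w - w'‖ * g w') ?_).aestronglyMeasurable
  refine Measurable.stronglyMeasurable ?_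
  exact (hκm.comp (measurable_fst.sub measurable_snd).norm).mul (hg.comp measurable_snd)

/-- The parametric set integral is bounded on the support disc:
`|∫_A κ ‖w − w'‖ g(w') dw'| ≤ B ∫_{B(0, 2ρ+1)} |κ ‖v‖| dv` for `‖w‖ ≤ ρ`. -/
theorem abs_setIntegral_kernel_mul_le (hκ : ∀ r, IntegrableOn (fun v : ℂ ↦ κ ‖v‖) (ball 0 r))
    (hg : Measurable g) (hB : ∀ z, |g z| ≤ B) (hρ : ∀ z, ρ < ‖z‖ → g z = 0) (A : Set ℂ)
    {w : ℂ} (hw : ‖w‖ ≤ ρ) :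
    |∫ w' in A, κ ‖w - w'‖ * g w'| ≤ B * ∫ v in ball (0 : ℂ) (2 * ρ + 1), |κ ‖v‖| := by
  have hB0 : 0 ≤ B := (abs_nonneg _).trans (hB 0)
  have hint := integrable_kernel_mul hκ hg hB hρ w
  calc |∫ w' in A, κ ‖w - w'‖ * g w'|
      ≤ ∫ w' in A, |κ ‖w - w'‖ * g w'| := abs_integral_le_integral_abs
    _ ≤ ∫ w', |κ ‖w - w'‖ * g w'| :=
        setIntegral_le_integral hint.abs (ae_of_all _ fun w' ↦ abs_nonneg _)
    _ = ∫ w', |κ ‖w - w'‖| * |g w'| := by simp_rw [abs_mul]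
    _ ≤ B * ∫ v in ball (0 : ℂ) (‖w‖ + ρ + 1), |κ ‖v‖| := integral_abs_kernel_mul_le hκ hB hρ w
    _ ≤ B * ∫ v in ball (0 : ℂ) (2 * ρ + 1), |κ ‖v‖| := by
        refine mul_le_mul_of_nonneg_left (setIntegral_mono_set (hκ _).abs
          (ae_of_all _ fun v ↦ abs_nonneg _)
          (Eventually.of_forall (ball_subset_ball (by linarith)))) hB0

/-- **The outer integrand is integrable**: `w ↦ g(w) ∫_A κ ‖w − w'‖ g(w') dw'` (bounded on the
support disc, zero outside). -/
theorem integrable_mul_setIntegral_kernel (hκm : Measurable κ)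
    (hκ : ∀ r, IntegrableOn (fun v : ℂ ↦ κ ‖v‖) (ball 0 r)) (hg : Measurable g)
    (hB : ∀ z, |g z| ≤ B) (hρ : ∀ z, ρ < ‖z‖ → g z = 0) (A : Set ℂ) :
    Integrable (fun w : ℂ ↦ g w * ∫ w' in A, κ ‖w - w'‖ * g w') := by
  set K := ∫ v in ball (0 : ℂ) (2 * ρ + 1), |κ ‖v‖| with hK
  have hmeas : AEStronglyMeasurable (fun w : ℂ ↦ g w * ∫ w' in A, κ ‖w - w'‖ * g w') volume :=
    hg.aestronglyMeasurable.mul (aestronglyMeasurable_setIntegral_kernel hκm hg A)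
  refine IntegrableOn.integrable_of_forall_notMem_eq_zero (s := closedBall (0 : ℂ) ρ) ?_
    fun w hw ↦ by rw [hρ w (by simpa [not_le] using hw), zero_mul]
  refine Measure.integrableOn_of_bounded (M := B * (B * K)) measure_closedBall_lt_top.ne hmeas ?_
  refine (ae_restrict_iff' measurableSet_closedBall).2 (ae_of_all _ fun w hw ↦ ?_)
  rw [mem_closedBall_zero_iff] at hw
  rw [norm_mul, Real.norm_eq_abs, Real.norm_eq_abs]
  exact mul_le_mul (hB w) (abs_setIntegral_kernel_mul_le hκ hg hB hρ A hw) (abs_nonneg _)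
    ((abs_nonneg _).trans (hB w))

/-- **Cell decomposition of the energy**: if moreover `g` vanishes a.e. off the cells of `S`,
`∫∫ κ‖w − w'‖ g(w) g(w') dw' dw = Σ_{x ∈ S} Σ_{y ∈ S} ∫_{H_x} g(w) ∫_{H_y} κ‖w − w'‖ g(w') dw' dw`. -/
theorem energy_eq_sum_sum (hκm : Measurable κ)
    (hκ : ∀ r, IntegrableOn (fun v : ℂ ↦ κ ‖v‖) (ball 0 r)) (hg : Measurable g)
    (hB : ∀ z, |g z| ≤ B) (hρ : ∀ z, ρ < ‖z‖ → g z = 0) (S : Finset (Site 2))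
    (hcover : ∀ᵐ z ∂(volume : Measure ℂ), z ∉ (⋃ x ∈ S, 𝓗[x]) → g z = 0) :
    ∫ w, ∫ w', κ ‖w - w'‖ * g w * g w' =
      ∑ x ∈ S, ∑ y ∈ S, ∫ w in 𝓗[x], g w * ∫ w' in 𝓗[y], κ ‖w - w'‖ * g w' := by
  have hHm : ∀ x ∈ S, MeasurableSet 𝓗[x] := fun x _ ↦ measurableSet_hexCell x
  have hdisj : ((S : Set (Site 2))).PairwiseDisjoint (fun x : Site 2 ↦ 𝓗[x]) :=
    fun x _ y _ hxy ↦ disjoint_hexCell hxy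
  -- inner decomposition, pointwise in `w`
  have hinner : ∀ w, ∫ w', κ ‖w - w'‖ * g w * g w' =
      g w * ∑ y ∈ S, ∫ w' in 𝓗[y], κ ‖w - w'‖ * g w' := by
    intro w
    have h1 : ∫ w', κ ‖w - w'‖ * g w * g w' = g w * ∫ w', κ ‖w - w'‖ * g w' := by
      rw [← integral_const_mul]
      refine integral_congr_ae (ae_of_all _ fun w' ↦ ?_)
      ring
    rw [h1, integral_eq_sum_setIntegral S hHm hdisj (integrable_kernel_mul hκ hg hB hρ w) ?_]
    filter_upwards [hcover] with z hz hzU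
    rw [hz hzU, mul_zero]
  simp_rw [hinner]
  have hsum : (fun w ↦ g w * ∑ y ∈ S, ∫ w' in 𝓗[y], κ ‖w - w'‖ * g w') =
      fun w ↦ ∑ y ∈ S, g w * ∫ w' in 𝓗[y], κ ‖w - w'‖ * g w' :=
    funext fun w ↦ Finset.mul_sum _ _ _
  have hint : Integrable (fun w ↦ g w * ∑ y ∈ S, ∫ w' in 𝓗[y], κ ‖w - w'‖ * g w') := by
    rw [hsum]
    exact integrable_finsetSum S fun y _ ↦ integrable_mul_setIntegral_kernel hκm hκ hg hB hρ _
  rw [integral_eq_sum_setIntegral S hHm hdisj hint ?_]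
  · refine Finset.sum_congr rfl fun x _ ↦ ?_
    rw [hsum, integral_finsetSum S fun y _ ↦
      (integrable_mul_setIntegral_kernel hκm hκ hg hB hρ _).integrableOn]
  · filter_upwards [hcover] with z hz hzU
    rw [hz hzU, zero_mul]

end Kernel

/-! ## The dilated density and the registered sub-goal -/

section Dilate

variable {f : ℂ → ℝ} {R C : ℝ}

/-- The dilated density `δ² f(δ ·)` of a measurable `f` is measurable. -/
theorem measurable_dilate (hf : Measurable f) (δ : ℝ) :
    Measurable (fun z : ℂ ↦ δ ^ 2 * f ((δ : ℂ) * z)) :=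
  (hf.comp (measurable_const.mul measurable_id)).const_mul _

/-- The dilated density is bounded by `δ²C`. -/
theorem abs_dilate_le (hC : ∀ z, |f z| ≤ C) (δ : ℝ) (z : ℂ) :
    |δ ^ 2 * f ((δ : ℂ) * z)| ≤ δ ^ 2 * C := by
  have := norm_dilate_le hC δ z
  rwa [Real.norm_eq_abs] at this

/-- The dilated density vanishes off `B̄(0, |R|/δ)`. -/
theorem dilate_eq_zero_of_lt_norm (hR : ∀ z, R < ‖z‖ → f z = 0) {δ : ℝ} (hδ : 0 < δ) (z : ℂ)
    (hz : |R| / δ < ‖z‖) : δ ^ 2 * f ((δ : ℂ) * z) = 0 := by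
  by_contra hne
  have h1 := norm_le_of_dilate_ne_zero hR hδ hne
  have h2 : R / δ ≤ |R| / δ := div_le_div_of_nonneg_right (le_abs_self R) hδ.le
  linarith

/-- **Sub-goal `riemannLog_energyCellDecomposition` of stub `stub_riemannLog`: the logarithmic
energy of the dilated density `f_δ = δ² f(δ ·)` of an admissible `f` decomposes over the pairs of
open Voronoi hexagons of the charge sites `triBall ⌈2(R/δ + 1)⌉₊`:
`∫∫ log‖w − w'‖ f_δ(w) f_δ(w') = Σ_x Σ_y ∫_{H_x} f_δ(w) ∫_{H_y} log‖w − w'‖ f_δ(w')`.** -/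
theorem riemannLog_energyCellDecomposition : ∀ (f : ℂ → ℝ) (R C δ : ℝ), Measurable f →
    (∀ z, |f z| ≤ C) → (∀ z, R < ‖z‖ → f z = 0) → 0 < δ →
    ∫ w, ∫ w', Real.log ‖w - w'‖ * (δ ^ 2 * f ((δ : ℂ) * w)) * (δ ^ 2 * f ((δ : ℂ) * w')) =
      ∑ x ∈ triBall ⌈2 * (R / δ + 1)⌉₊, ∑ y ∈ triBall ⌈2 * (R / δ + 1)⌉₊,
        ∫ w in {z : ℂ | ∀ i : Fin 3, |hform i (z - triMeshPoint 1 x)| < 1},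
          δ ^ 2 * f ((δ : ℂ) * w) *
            ∫ w' in {z : ℂ | ∀ i : Fin 3, |hform i (z - triMeshPoint 1 y)| < 1},
              Real.log ‖w - w'‖ * (δ ^ 2 * f ((δ : ℂ) * w')) := by
  intro f R C δ hf hC hR hδ
  exact energy_eq_sum_sum (κ := Real.log) (g := fun z : ℂ ↦ δ ^ 2 * f ((δ : ℂ) * z))
    Real.measurable_log (fun r ↦ integrableOn_log_norm_ball r) (measurable_dilate hf δ)
    (abs_dilate_le hC δ) (dilate_eq_zero_of_lt_norm hR hδ) (triBall ⌈2 * (R / δ + 1)⌉₊)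
    (ae_dilate_eq_zero_off_cells hR hδ)

end Dilate

end Summit.CriticalPhenomena.CardyFormulaZ2.Cruxes.MagicFormulaT.LineSketch

end
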